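import Mathlib.LinearAlgebra.Matrix.Charpoly.Coeff
import Mathlib.LinearAlgebra.Matrix.PosDef
import Mathlib.LinearAlgebra.Trace
import Mathlib.LinearAlgebra.Projection
import Mathlib.LinearAlgebra.FiniteDimensional.Lemmas
import Literature.LinearAlgebra.Matrix.SimpleSpectrumProjections
import HarnessLib

/-!
# An explicit polynomial symmetrizer for matrices with simple real spectrum

A real square matrix `M` with `k` distinct real eigenvalues (the single-matrix case of a
*strictly hyperbolic* pencil) is **symmetrizable**: there is a symmetric positive definite `H`
with `HM` symmetric, i.e. `HM = MᵀH` — "`A` is diagonalizable and has real eigenvalues" iff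
"`A` is similar to `A*` via a positive definite similarity" [HornJohnson2013, §7.6 Problem
7.6.P1 (b) ⇔ (d); Cor. 7.6.2 (a)]. The textbook symmetrizer is `H = Σₐ ℓₐᵀℓₐ = P⁻ᵀP⁻¹` for a
basis of left eigenvectors `ℓₐ` (rows of `P⁻¹`, `P⁻¹MP = Λ`; for one-dimensional hyperbolic
systems this is the diagonalisation `P⁻¹S⁻¹AP = Λ` of [AlinhacHPDE2009, Ch. 2 §2.2]).

This file constructs such an `H` as an explicit POLYNOMIAL in the entries of `M` — so that it
depends smoothly (polynomially) on parameters, with no choice of eigenvectors — and proves its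
properties:

* `hornerPoly p k s = Σ_{m < k-s} p_{m+s+1} Xᵐ` — the Horner quotients of `p = Σ pᵣXʳ`, i.e. the
  coefficients of `Yˢ` in `(p(X) - p(Y))/(X - Y)`; `X · hornerPoly p k (s+1) = hornerPoly p k s -
  p_{s+1}` and `X · hornerPoly p k 0 = p - p₀`; for every `a`,
  `(Σₛ aˢ hornerPoly p k s)(X - a) = p - p(a)` (`sum_C_pow_mul_hornerPoly_mul_X_sub_C`,
  synthetic division).
* `hornerMatrix M s = (hornerPoly (charpoly M) k s)(M)` (`k = card n`) and the **symmetrizer**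
  `hornerSymmetrizer M = Σ_{s,s' < k} tr(M^{s+s'}) · (hornerMatrix M s)ᵀ hornerMatrix M s'`,
  over any commutative ring: it is symmetric (`isSymm_hornerSymmetrizer`), and
  `hornerSymmetrizer M · M = Σ_{s,s'} tr(M^{s+s'+1}) Nₛᵀ N_{s'}` is symmetric too
  (`hornerSymmetrizer_mul`, `isSymm_hornerSymmetrizer_mul`, hence `HM = MᵀH`,
  `hornerSymmetrizer_mul_eq_transpose_mul`) — by Cayley–Hamilton (`tr(Mˢ p(M)) = 0`) and the
  Horner recursion; it is functorial under ring homomorphisms (`hornerSymmetrizer_map`), being a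
  polynomial in the entries.
* over a field, when `charpoly M = ∏ₐ (X - μₐ)` with the `μₐ` pairwise distinct:
  `hornerSymmetrizer M = Σₐ tr(Πₐ) · Qₐᵀ Qₐ` with `Qₐ = ∏_{b ≠ a} (M - μ_b) = Σₛ μₐˢ Nₛ` and `Πₐ`
  the Lagrange spectral projections of
  `Literature/LinearAlgebra/Matrix/SimpleSpectrumProjections.lean`
  (`hornerSymmetrizer_eq_sum_lagrange`); over `ℝ`, `tr(Πₐ) = rank Πₐ ≥ 1` and `Σₐ wₐQₐ = 1`, so
  `H` is POSITIVE DEFINITE (`posDef_hornerSymmetrizer`) — the symmetrizer of [HornJohnson2013,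
  7.6.P1 (d)] in closed form (`tr(Mⁱ⁺ʲ)` is the Hankel matrix of Newton sums of the eigenvalues,
  Hermite's form, transported by the Horner matrices).

Used for: one-dimensional strictly hyperbolic quasilinear systems are symmetrizable, with a
symmetrizer depending smoothly on the state (finite speed of propagation,
`Literature/Barriers/AtomisticToContinuum/NoBVEstimatesMultiDFinitePropagation*.lean`), and the
symbolic symmetrizer `H(Σ ωⱼAⱼ)` of a strictly hyperbolic pencil, continuous on the sphere.

## References

* [HornJohnson2013] R. A. Horn, C. R. Johnson, *Matrix Analysis*, 2nd ed. (2013), §7.6,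
  Problem 7.6.P1 and Corollary 7.6.2.
* [AlinhacHPDE2009] S. Alinhac, *Hyperbolic Partial Differential Equations* (2009), Ch. 2 §2.2
  (Def. 2.11 and the diagonalisation of strictly hyperbolic systems in one space dimension).
-/

noncomputable section

open Polynomial Finset Matrix

namespace Literature.LinearAlgebra.Matrix

/-! ### Horner quotients of a polynomial -/

section Horner

variable {R : Type*} [CommRing R]

/-- **Horner quotients** of `p = Σᵣ pᵣ Xʳ` truncated at degree `k`:
`hornerPoly p k s = Σ_{m < k - s} p_{m+s+1} Xᵐ`, the coefficient of `Yˢ` in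
`(p(X) - p(Y))/(X - Y)` when `deg p ≤ k`. [folklore] -/
def hornerPoly (p : R[X]) (k s : ℕ) : R[X] :=
  ∑ m ∈ range (k - s), C (p.coeff (m + s + 1)) * X ^ m

/-- Beyond the truncation degree the Horner quotients vanish. [folklore] -/
theorem hornerPoly_of_le (p : R[X]) {k s : ℕ} (h : k ≤ s) : hornerPoly p k s = 0 := by
  rw [hornerPoly, Nat.sub_eq_zero_of_le h, sum_range_zero]

/-- The last Horner quotient is the constant `p_k`. [folklore] -/
theorem hornerPoly_pred (p : R[X]) (k : ℕ) : hornerPoly p (k + 1) k = C (p.coeff (k + 1)) := by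
  simp [hornerPoly]

/-- **Horner recursion**: `X · hornerPoly p k (s+1) = hornerPoly p k s - p_{s+1}` for `s < k`.
[folklore] -/
theorem X_mul_hornerPoly_succ (p : R[X]) {k s : ℕ} (hs : s < k) :
    X * hornerPoly p k (s + 1) = hornerPoly p k s - C (p.coeff (s + 1)) := by
  unfold hornerPoly
  obtain ⟨r, hr⟩ : ∃ r, k - s = r + 1 := ⟨k - s - 1, by omega⟩
  have hr' : k - (s + 1) = r := by omega
  rw [hr, hr', sum_range_succ', pow_zero, mul_one, zero_add, add_sub_cancel_right, mul_sum]
  refine sum_congr rfl fun m _ => ?_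
  rw [show m + (s + 1) + 1 = m + 1 + s + 1 by ring]
  ring

/-- **Horner recursion at `s = 0`**: `X · hornerPoly p k 0 = p - p₀` when `deg p ≤ k`. [folklore] -/
theorem X_mul_hornerPoly_zero (p : R[X]) {k : ℕ} (hp : p.natDegree ≤ k) :
    X * hornerPoly p k 0 = p - C (p.coeff 0) := by
  have key : X * hornerPoly p k 0 + C (p.coeff 0) = p := by
    conv_rhs => rw [p.as_sum_range_C_mul_X_pow' (Nat.lt_succ_of_le hp)]
    rw [sum_range_succ', pow_zero, mul_one, hornerPoly, Nat.sub_zero, mul_sum]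
    congr 1
    refine sum_congr rfl fun m _ => ?_
    rw [add_zero]
    ring
  exact eq_sub_of_add_eq key

/-- **Telescoping identity** (synthetic division): for `deg p ≤ k` and any `a`,
`(Σ_{s<k} aˢ · hornerPoly p k s) · (X - a) = p - p(a)`. [folklore] -/
theorem sum_C_pow_mul_hornerPoly_mul_X_sub_C (p : R[X]) {k : ℕ} (hp : p.natDegree ≤ k) (a : R) :
    (∑ s ∈ range k, C (a ^ s) * hornerPoly p k s) * (X - C a) = p - C (p.eval a) := by
  -- the case `k = 0`: `p` is a constant
  rcases Nat.eq_zero_or_pos k with rfl | hk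
  · rw [sum_range_zero, zero_mul, eq_comm, sub_eq_zero]
    have h0 : p.natDegree = 0 := Nat.le_zero.1 hp
    conv_lhs => rw [eq_C_of_natDegree_eq_zero h0]
    rw [eval_eq_sum_range' (Nat.lt_succ_of_le hp), sum_range_one, pow_zero, mul_one]
  obtain ⟨k', rfl⟩ : ∃ k', k = k' + 1 := ⟨k - 1, by omega⟩
  set Q : R[X] := ∑ s ∈ range (k' + 1), C (a ^ s) * hornerPoly p (k' + 1) s with hQ
  have hXQ : X * Q = p + C a * Q - C (p.eval a) := by
    have hsplit : X * Q = X * (C (a ^ 0) * hornerPoly p (k' + 1) 0) +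
        ∑ s ∈ range k', X * (C (a ^ (s + 1)) * hornerPoly p (k' + 1) (s + 1)) := by
      rw [hQ, sum_range_succ', mul_add, mul_sum, add_comm]
    have h0 : X * (C (a ^ 0) * hornerPoly p (k' + 1) 0) = p - C (p.coeff 0) := by
      rw [pow_zero, C_1, one_mul, X_mul_hornerPoly_zero p hp]
    have hs : ∀ s ∈ range k', X * (C (a ^ (s + 1)) * hornerPoly p (k' + 1) (s + 1)) =
        C a * (C (a ^ s) * hornerPoly p (k' + 1) s) - C (a ^ (s + 1)) * C (p.coeff (s + 1)) := by
      intro s hs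
      have hsk : s < k' + 1 := Nat.lt_succ_of_lt (mem_range.1 hs)
      rw [mul_left_comm, X_mul_hornerPoly_succ p hsk, mul_sub]
      simp only [C_pow]
      ring
    -- `Σ_{s<k'} C(aˢ) horner s = Q - C(a^{k'}) horner k'` and `horner k' = C p_{k'+1}`
    have hQ' : ∑ s ∈ range k', C (a ^ s) * hornerPoly p (k' + 1) s =
        Q - C (a ^ k') * C (p.coeff (k' + 1)) := by
      rw [hQ, sum_range_succ, hornerPoly_pred, add_sub_cancel_right]
    have heval : C (p.eval a) = ∑ s ∈ range k', C (a ^ (s + 1)) * C (p.coeff (s + 1)) +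
        C (p.coeff 0) + C a * (C (a ^ k') * C (p.coeff (k' + 1))) := by
      rw [eval_eq_sum_range' (Nat.lt_succ_of_le hp), sum_range_succ, sum_range_succ', map_add,
        map_add, map_sum]
      congr 1
      · congr 1
        · exact sum_congr rfl fun s _ => by rw [C_mul, mul_comm]
        · rw [pow_zero, mul_one]
      · rw [← C_mul, ← C_mul]
        congr 1
        ring
    rw [hsplit, h0, sum_congr rfl hs, sum_sub_distrib, ← mul_sum, hQ', heval]
    ring
  calc Q * (X - C a) = X * Q - C a * Q := by ring
    _ = p - C (p.eval a) := by rw [hXQ]; ring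

/-- The Horner quotients commute with ring homomorphisms. [folklore] -/
theorem hornerPoly_map {S : Type*} [CommRing S] (f : R →+* S) (p : R[X]) (k s : ℕ) :
    hornerPoly (p.map f) k s = (hornerPoly p k s).map f := by
  simp [hornerPoly, Polynomial.map_sum, coeff_map]

end Horner

/-! ### The Horner matrices and the symmetrizer -/

section Ring

variable {R : Type*} [CommRing R] {n : Type*} [Fintype n] [DecidableEq n]

/-- The characteristic polynomial has degree at most the size (`=` over a nontrivial ring).
[folklore] -/
theorem natDegree_charpoly_le (M : Matrix n n R) : M.charpoly.natDegree ≤ Fintype.card n := by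
  rcases subsingleton_or_nontrivial R with hR | hR
  · rw [Subsingleton.elim M.charpoly 0, natDegree_zero]
    exact Nat.zero_le _
  · exact (Matrix.charpoly_natDegree_eq_dim M).le

/-- Over any ring, the coefficient of `X^{card n}` in the characteristic polynomial is `1`.
[folklore] -/
theorem charpoly_coeff_card (M : Matrix n n R) : M.charpoly.coeff (Fintype.card n) = 1 := by
  rcases subsingleton_or_nontrivial R with hR | hR
  · exact Subsingleton.elim _ _
  · rw [← Matrix.charpoly_natDegree_eq_dim M, Polynomial.coeff_natDegree]
    exact Matrix.charpoly_monic M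

/-- **Horner matrices** `Nₛ = (hornerPoly (charpoly M) k s)(M) = Σ_{m < k-s} p_{m+s+1} Mᵐ`,
`k = card n`, `p = charpoly M`. [folklore] -/
def hornerMatrix (M : Matrix n n R) (s : ℕ) : Matrix n n R :=
  aeval M (hornerPoly M.charpoly (Fintype.card n) s)

/-- **The polynomial symmetrizer** `H(M) = Σ_{s,s' < k} tr(M^{s+s'}) · Nₛᵀ N_{s'}`, a polynomial
in the entries of `M` (the Hankel matrix of the power traces `tr Mⁱ⁺ʲ` transported by the
Horner matrices). [cite: HornJohnson2013, §7.6 Problem 7.6.P1] -/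
def hornerSymmetrizer (M : Matrix n n R) : Matrix n n R :=
  ∑ s ∈ range (Fintype.card n), ∑ s' ∈ range (Fintype.card n),
    (M ^ (s + s')).trace • ((hornerMatrix M s)ᵀ * hornerMatrix M s')

/-- Polynomials in `M` commute with `M`. [folklore] -/
theorem aeval_mul_self_comm (M : Matrix n n R) (q : R[X]) : aeval M q * M = M * aeval M q := by
  have h : aeval M (q * X) = aeval M (X * q) := by rw [mul_comm]
  rwa [map_mul, map_mul, aeval_X] at h

/-- The Horner matrices commute with `M`. [folklore] -/
theorem hornerMatrix_mul_comm (M : Matrix n n R) (s : ℕ) :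
    hornerMatrix M s * M = M * hornerMatrix M s :=
  aeval_mul_self_comm M _

/-- **Matrix Horner recursion**: `M N_{s+1} = Nₛ - p_{s+1} · 1` for `s < k`. [folklore] -/
theorem mul_hornerMatrix_succ (M : Matrix n n R) {s : ℕ} (hs : s < Fintype.card n) :
    M * hornerMatrix M (s + 1) =
      hornerMatrix M s - M.charpoly.coeff (s + 1) • (1 : Matrix n n R) := by
  have h := congr_arg (aeval M) (X_mul_hornerPoly_succ M.charpoly hs)
  rwa [map_mul, aeval_X, map_sub, aeval_C, Algebra.algebraMap_eq_smul_one] at h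

/-- **Matrix Horner recursion at `s = 0`** (Cayley–Hamilton): `M N₀ = -p₀ · 1`. [folklore] -/
theorem mul_hornerMatrix_zero (M : Matrix n n R) :
    M * hornerMatrix M 0 = -(M.charpoly.coeff 0 • (1 : Matrix n n R)) := by
  have h := congr_arg (aeval M) (X_mul_hornerPoly_zero M.charpoly (natDegree_charpoly_le M))
  rwa [map_mul, aeval_X, map_sub, Matrix.aeval_self_charpoly, aeval_C,
    Algebra.algebraMap_eq_smul_one, zero_sub] at h

/-- The last Horner matrix is the identity: `N_{k-1} = p_k · 1 = 1` (`k ≥ 1`). [folklore] -/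
theorem hornerMatrix_pred (M : Matrix n n R) {k' : ℕ} (hk : Fintype.card n = k' + 1) :
    hornerMatrix M k' = 1 := by
  have h1 : M.charpoly.coeff (k' + 1) = 1 := by rw [← hk]; exact charpoly_coeff_card M
  unfold hornerMatrix
  rw [hk, hornerPoly_pred, aeval_C, Algebra.algebraMap_eq_smul_one, h1, one_smul]

/-- **Cayley–Hamilton, traced**: `Σ_{r ≤ k} pᵣ tr(M^{s+r}) = tr(Mˢ p(M)) = 0`. [folklore] -/
theorem sum_coeff_mul_trace_pow (M : Matrix n n R) (s : ℕ) :
    ∑ r ∈ range (Fintype.card n + 1), M.charpoly.coeff r * (M ^ (s + r)).trace = 0 := by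
  have h : M ^ s * aeval M M.charpoly = 0 := by rw [Matrix.aeval_self_charpoly, mul_zero]
  rw [aeval_eq_sum_range' (Nat.lt_succ_of_le (natDegree_charpoly_le M)), mul_sum] at h
  have h2 := congr_arg Matrix.trace h
  rw [trace_sum, trace_zero] at h2
  rw [← h2]
  refine sum_congr rfl fun r _ => ?_
  rw [mul_smul_comm, ← pow_add, trace_smul, smul_eq_mul]

/-- **The key identity**: `Σ_{s'<k} tr(M^{s+s'}) N_{s'} M = Σ_{s'<k} tr(M^{s+s'+1}) N_{s'}` for
every `s` (Horner recursion and the traced Cayley–Hamilton identity). [folklore] -/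
theorem sum_trace_smul_hornerMatrix_mul (M : Matrix n n R) (s : ℕ) :
    ∑ s' ∈ range (Fintype.card n), (M ^ (s + s')).trace • (hornerMatrix M s' * M) =
      ∑ s' ∈ range (Fintype.card n), (M ^ (s + s' + 1)).trace • hornerMatrix M s' := by
  rcases Nat.eq_zero_or_pos (Fintype.card n) with hk | hk
  · rw [hk, sum_range_zero, sum_range_zero]
  obtain ⟨k', hk'⟩ : ∃ k', Fintype.card n = k' + 1 := ⟨Fintype.card n - 1, by omega⟩
  -- left-hand side: split off `s' = 0` and use the recursions
  have hL : ∑ s' ∈ range (Fintype.card n), (M ^ (s + s')).trace • (hornerMatrix M s' * M) =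
      ∑ s' ∈ range k', (M ^ (s + s' + 1)).trace • hornerMatrix M s' -
        (∑ s' ∈ range k', (M ^ (s + s' + 1)).trace * M.charpoly.coeff (s' + 1) +
          (M ^ s).trace * M.charpoly.coeff 0) • (1 : Matrix n n R) := by
    rw [hk', sum_range_succ']
    have h0 : (M ^ (s + 0)).trace • (hornerMatrix M 0 * M) =
        -(((M ^ s).trace * M.charpoly.coeff 0) • (1 : Matrix n n R)) := by
      rw [add_zero, hornerMatrix_mul_comm, mul_hornerMatrix_zero, smul_neg, smul_smul]
    have hs' : ∀ s' ∈ range k', (M ^ (s + (s' + 1))).trace • (hornerMatrix M (s' + 1) * M) =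
        (M ^ (s + s' + 1)).trace • hornerMatrix M s' -
          ((M ^ (s + s' + 1)).trace * M.charpoly.coeff (s' + 1)) • (1 : Matrix n n R) := by
      intro s' hs'
      have hlt : s' < Fintype.card n := by
        have := mem_range.1 hs'
        omega
      rw [hornerMatrix_mul_comm, mul_hornerMatrix_succ M hlt, smul_sub, smul_smul, ← add_assoc]
    rw [h0, sum_congr rfl hs', sum_sub_distrib, ← sum_smul, add_smul]
    abel
  -- the traced Cayley–Hamilton identity closes the scalar sum
  have hscal : ∑ s' ∈ range k', (M ^ (s + s' + 1)).trace * M.charpoly.coeff (s' + 1) +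
      (M ^ s).trace * M.charpoly.coeff 0 = -(M ^ (s + (k' + 1))).trace := by
    have h := sum_coeff_mul_trace_pow M s
    have hlead : M.charpoly.coeff (k' + 1) = 1 := by rw [← hk']; exact charpoly_coeff_card M
    rw [hk', sum_range_succ, sum_range_succ', hlead, one_mul, add_zero] at h
    rw [eq_neg_iff_add_eq_zero, ← h]
    have hcomm : ∀ x ∈ range k', (M ^ (s + x + 1)).trace * M.charpoly.coeff (x + 1) =
        M.charpoly.coeff (x + 1) * (M ^ (s + (x + 1))).trace := by
      intro x _
      rw [mul_comm, add_assoc]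
    rw [sum_congr rfl hcomm, mul_comm ((M ^ s).trace)]
  -- right-hand side: split off `s' = k'`, where `N_{k'} = 1`
  have hR : ∑ s' ∈ range (Fintype.card n), (M ^ (s + s' + 1)).trace • hornerMatrix M s' =
      ∑ s' ∈ range k', (M ^ (s + s' + 1)).trace • hornerMatrix M s' +
        (M ^ (s + (k' + 1))).trace • (1 : Matrix n n R) := by
    rw [hk', sum_range_succ, hornerMatrix_pred M hk', ← add_assoc]
  rw [hL, hR, hscal, neg_smul, sub_neg_eq_add]

/-- **`H(M) · M` in closed form**: `hornerSymmetrizer M · M = Σ_{s,s'<k} tr(M^{s+s'+1}) Nₛᵀ N_{s'}`.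
[folklore] -/
theorem hornerSymmetrizer_mul (M : Matrix n n R) :
    hornerSymmetrizer M * M = ∑ s ∈ range (Fintype.card n), ∑ s' ∈ range (Fintype.card n),
      (M ^ (s + s' + 1)).trace • ((hornerMatrix M s)ᵀ * hornerMatrix M s') := by
  unfold hornerSymmetrizer
  rw [sum_mul]
  refine sum_congr rfl fun s _ => ?_
  calc (∑ s' ∈ range (Fintype.card n),
          (M ^ (s + s')).trace • ((hornerMatrix M s)ᵀ * hornerMatrix M s')) * M
        = ∑ s' ∈ range (Fintype.card n),
            (M ^ (s + s')).trace • ((hornerMatrix M s)ᵀ * (hornerMatrix M s' * M)) := by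
          rw [sum_mul]
          exact sum_congr rfl fun s' _ => by rw [smul_mul_assoc, Matrix.mul_assoc]
    _ = (hornerMatrix M s)ᵀ *
          ∑ s' ∈ range (Fintype.card n), (M ^ (s + s')).trace • (hornerMatrix M s' * M) := by
          rw [mul_sum]
          exact sum_congr rfl fun s' _ => by rw [mul_smul_comm]
    _ = (hornerMatrix M s)ᵀ *
          ∑ s' ∈ range (Fintype.card n), (M ^ (s + s' + 1)).trace • hornerMatrix M s' := by
          rw [sum_trace_smul_hornerMatrix_mul]
    _ = ∑ s' ∈ range (Fintype.card n),
          (M ^ (s + s' + 1)).trace • ((hornerMatrix M s)ᵀ * hornerMatrix M s') := by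
          rw [mul_sum]
          exact sum_congr rfl fun s' _ => by rw [mul_smul_comm]

omit [DecidableEq n] in
/-- A double sum `Σ_{s,s'} c(s+s') Aₛᵀ A_{s'}` with symmetric weights is a symmetric matrix.
[folklore] -/
theorem isSymm_sum_sum_smul_transpose_mul (A : ℕ → Matrix n n R) (c : ℕ → R) (k : ℕ) :
    (∑ s ∈ range k, ∑ s' ∈ range k, c (s + s') • ((A s)ᵀ * A s')).IsSymm := by
  unfold Matrix.IsSymm
  rw [transpose_sum]
  simp_rw [transpose_sum, transpose_smul, transpose_mul, transpose_transpose]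
  rw [sum_comm]
  refine sum_congr rfl fun s _ => sum_congr rfl fun s' _ => ?_
  rw [add_comm]

/-- **`H(M)` is symmetric.** [cite: HornJohnson2013, §7.6 Problem 7.6.P1] -/
theorem isSymm_hornerSymmetrizer (M : Matrix n n R) : (hornerSymmetrizer M).IsSymm :=
  isSymm_sum_sum_smul_transpose_mul (hornerMatrix M) (fun j => (M ^ j).trace) _

/-- **`H(M) · M` is symmetric.** [cite: HornJohnson2013, §7.6 Problem 7.6.P1] -/
theorem isSymm_hornerSymmetrizer_mul (M : Matrix n n R) : (hornerSymmetrizer M * M).IsSymm := by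
  rw [hornerSymmetrizer_mul]
  exact isSymm_sum_sum_smul_transpose_mul (hornerMatrix M) (fun j => (M ^ (j + 1)).trace) _

/-- **`H M = Mᵀ H`**: `M` is intertwined with its transpose by the symmetric matrix `H(M)`
("similar to `A*` via a positive definite similarity", once `H` is known to be definite).
[cite: HornJohnson2013, §7.6 Problem 7.6.P1 (d)] -/
theorem hornerSymmetrizer_mul_eq_transpose_mul (M : Matrix n n R) :
    hornerSymmetrizer M * M = Mᵀ * hornerSymmetrizer M := by
  have h := isSymm_hornerSymmetrizer_mul M
  unfold Matrix.IsSymm at h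
  rw [transpose_mul, (isSymm_hornerSymmetrizer M).eq] at h
  exact h.symm

/-! ### Functoriality: `H` is a polynomial in the entries -/

variable {S : Type*} [CommRing S]

/-- `aeval` on matrices commutes with entrywise ring homomorphisms. [folklore] -/
theorem map_aeval (f : R →+* S) (M : Matrix n n R) (q : R[X]) :
    (aeval M q).map f = aeval (M.map f) (q.map f) := by
  have hcomm : (algebraMap S (Matrix n n S)).comp f =
      f.mapMatrix.comp (algebraMap R (Matrix n n R)) := by
    ext r i j
    simp [RingHom.mapMatrix_apply, Matrix.algebraMap_matrix_apply, apply_ite f]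
  have h := Polynomial.map_aeval_eq_aeval_map hcomm q M
  simpa [RingHom.mapMatrix_apply] using h

/-- The Horner matrices commute with ring homomorphisms. [folklore] -/
theorem hornerMatrix_map (f : R →+* S) (M : Matrix n n R) (s : ℕ) :
    hornerMatrix (M.map f) s = (hornerMatrix M s).map f := by
  rw [hornerMatrix, hornerMatrix, Matrix.charpoly_map, hornerPoly_map, map_aeval]

omit [Fintype n] [DecidableEq n] in
/-- Entrywise ring homomorphisms and scalar multiplication. [folklore] -/
theorem map_smul_ringHom (f : R →+* S) (c : R) (A : Matrix n n R) :
    (c • A).map f = f c • A.map f := by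
  ext i j
  simp

omit [DecidableEq n] in
/-- Entrywise ring homomorphisms and the trace. [folklore] -/
theorem trace_map_ringHom (f : R →+* S) (A : Matrix n n R) : (A.map f).trace = f A.trace := by
  simp [Matrix.trace, map_sum]

/-- **`H(M)` commutes with ring homomorphisms** (it is a polynomial with integer coefficients in
the entries of `M`); in particular it depends continuously/smoothly/polynomially on parameters
when `M` does. [folklore] -/
theorem hornerSymmetrizer_map (f : R →+* S) (M : Matrix n n R) :
    hornerSymmetrizer (M.map f) = (hornerSymmetrizer M).map f := by
  rw [show (hornerSymmetrizer M).map f = f.mapMatrix (hornerSymmetrizer M) from rfl]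
  unfold hornerSymmetrizer
  rw [map_sum]
  refine sum_congr rfl fun s _ => ?_
  rw [map_sum]
  refine sum_congr rfl fun s' _ => ?_
  rw [RingHom.mapMatrix_apply, map_smul_ringHom, Matrix.map_mul, transpose_map,
    ← hornerMatrix_map, ← hornerMatrix_map, ← trace_map_ringHom, Matrix.map_pow]

end Ring

/-! ### Simple spectrum: `H = Σₐ tr(Πₐ) Qₐᵀ Qₐ` -/

section Field

variable {𝕜 : Type*} [Field 𝕜] {n ι : Type*} [Fintype n] [DecidableEq n] [Fintype ι]
  [DecidableEq ι] {M : Matrix n n 𝕜} {μ : ι → 𝕜}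

/-- The truncated Horner quotient `Qₐ = Σ_{s<k} aˢ Nₛ` at a scalar `a`. [folklore] -/
def hornerQuotient (M : Matrix n n 𝕜) (a : 𝕜) : Matrix n n 𝕜 :=
  ∑ s ∈ range (Fintype.card n), a ^ s • hornerMatrix M s

/-- `Qₐ = (Σₛ aˢ hornerPoly)(M)`. [folklore] -/
theorem hornerQuotient_eq_aeval (M : Matrix n n 𝕜) (a : 𝕜) :
    hornerQuotient M a =
      aeval M (∑ s ∈ range (Fintype.card n),
        C (a ^ s) * hornerPoly M.charpoly (Fintype.card n) s) := by
  rw [hornerQuotient, map_sum]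
  refine sum_congr rfl fun s _ => ?_
  rw [map_mul, aeval_C, Algebra.algebraMap_eq_smul_one, smul_mul_assoc, one_mul, hornerMatrix]

/-- Under `charpoly M = ∏ₐ (X - μₐ)`: **`Q_{μₐ} = ∏_{b ≠ a} (M - μ_b)`** — the synthetic division
`p/(X - μₐ) = ∏_{b≠a}(X - μ_b)` evaluated at `M`. [folklore] -/
theorem hornerQuotient_eq_aeval_nodal_erase (hchar : M.charpoly = ∏ a, (X - C (μ a))) (a : ι) :
    hornerQuotient M (μ a) = aeval M (Lagrange.nodal (univ.erase a) μ) := by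
  rw [hornerQuotient_eq_aeval]
  congr 1
  have h := sum_C_pow_mul_hornerPoly_mul_X_sub_C M.charpoly (natDegree_charpoly_le M) (μ a)
  have hroot : M.charpoly.eval (μ a) = 0 := by
    rw [hchar, eval_prod]
    exact prod_eq_zero (mem_univ a) (by simp)
  rw [hroot, C_0, sub_zero] at h
  conv at h => rhs; rw [hchar, ← Lagrange.nodal_eq, Lagrange.nodal_eq_mul_nodal_erase (mem_univ a),
    mul_comm]
  exact mul_right_cancel₀ (X_sub_C_ne_zero (μ a)) h

/-- **The Lagrange projection is a multiple of the Horner quotient**: `Πₐ = wₐ · Q_{μₐ}` with the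
nodal weight `wₐ = ∏_{b≠a} (μₐ - μ_b)⁻¹`. [folklore] -/
theorem lagrangeProj_eq_smul_hornerQuotient (hchar : M.charpoly = ∏ a, (X - C (μ a))) (a : ι) :
    lagrangeProj M μ a = Lagrange.nodalWeight univ μ a • hornerQuotient M (μ a) := by
  rw [hornerQuotient_eq_aeval_nodal_erase hchar, lagrangeProj,
    Lagrange.basis_eq_prod_sub_inv_mul_nodal_div (mem_univ a),
    ← Lagrange.nodal_erase_eq_nodal_div (mem_univ a), map_mul, aeval_C,
    Algebra.algebraMap_eq_smul_one, smul_mul_assoc, one_mul]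

/-- Powers act on the projections by powers of the eigenvalue: `Mʲ Πₐ = μₐʲ Πₐ`. [folklore] -/
theorem pow_mul_lagrangeProj (hchar : M.charpoly = ∏ a, (X - C (μ a))) (a : ι) (j : ℕ) :
    M ^ j * lagrangeProj M μ a = μ a ^ j • lagrangeProj M μ a := by
  induction j with
  | zero => rw [pow_zero, one_mul, pow_zero, one_smul]
  | succ j ih =>
      rw [pow_succ, Matrix.mul_assoc, mul_lagrangeProj hchar, mul_smul_comm, ih, smul_smul,
        pow_succ']

/-- **Spectral decomposition of powers**: `Mʲ = Σₐ μₐʲ Πₐ`. [folklore] -/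
theorem pow_eq_sum_smul_lagrangeProj (hμ : Function.Injective μ)
    (hchar : M.charpoly = ∏ a, (X - C (μ a))) (j : ℕ) :
    M ^ j = ∑ a, μ a ^ j • lagrangeProj M μ a := by
  conv_lhs => rw [← mul_one (M ^ j), ← sum_lagrangeProj hμ hchar, mul_sum]
  exact sum_congr rfl fun a _ => pow_mul_lagrangeProj hchar a j

/-- **Power traces are weighted Newton sums**: `tr(Mʲ) = Σₐ μₐʲ tr(Πₐ)`. [folklore] -/
theorem trace_pow_eq_sum_lagrangeProj (hμ : Function.Injective μ) (hchar : M.charpoly = ∏ a, (X - C (μ a)))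
    (j : ℕ) : (M ^ j).trace = ∑ a, μ a ^ j * (lagrangeProj M μ a).trace := by
  rw [pow_eq_sum_smul_lagrangeProj hμ hchar, trace_sum]
  exact sum_congr rfl fun a _ => by rw [trace_smul, smul_eq_mul]

/-- **`H(M) = Σₐ tr(Πₐ) · Qₐᵀ Qₐ`** under `charpoly M = ∏ₐ (X - μₐ)` with distinct `μₐ`:
substitute `tr(M^{s+s'}) = Σₐ μₐ^{s+s'} tr(Πₐ)` and factor the double sum. [folklore] -/
theorem hornerSymmetrizer_eq_sum_lagrange (hμ : Function.Injective μ)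
    (hchar : M.charpoly = ∏ a, (X - C (μ a))) :
    hornerSymmetrizer M =
      ∑ a, (lagrangeProj M μ a).trace • ((hornerQuotient M (μ a))ᵀ * hornerQuotient M (μ a)) := by
  set k := Fintype.card n with hk
  have hR : (∑ a, (lagrangeProj M μ a).trace •
      ((hornerQuotient M (μ a))ᵀ * hornerQuotient M (μ a))) =
      ∑ a, ∑ s ∈ range k, ∑ s' ∈ range k, (μ a ^ (s + s') * (lagrangeProj M μ a).trace) •
        ((hornerMatrix M s)ᵀ * hornerMatrix M s') := by
    refine sum_congr rfl fun a _ => ?_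
    rw [hornerQuotient, transpose_sum, sum_mul, smul_sum]
    refine sum_congr rfl fun s _ => ?_
    rw [mul_sum, smul_sum]
    refine sum_congr rfl fun s' _ => ?_
    rw [transpose_smul, smul_mul_assoc, mul_smul_comm, smul_smul, smul_smul, pow_add]
    congr 1
    ring
  have hL : hornerSymmetrizer M = ∑ s ∈ range k, ∑ s' ∈ range k, ∑ a,
      (μ a ^ (s + s') * (lagrangeProj M μ a).trace) • ((hornerMatrix M s)ᵀ * hornerMatrix M s') := by
    unfold hornerSymmetrizer
    refine sum_congr rfl fun s _ => sum_congr rfl fun s' _ => ?_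
    rw [trace_pow_eq_sum_lagrangeProj hμ hchar, sum_smul]
  rw [hL, hR]
  calc ∑ s ∈ range k, ∑ s' ∈ range k, ∑ a,
        (μ a ^ (s + s') * (lagrangeProj M μ a).trace) • ((hornerMatrix M s)ᵀ * hornerMatrix M s')
      = ∑ s ∈ range k, ∑ a, ∑ s' ∈ range k, (μ a ^ (s + s') * (lagrangeProj M μ a).trace) •
          ((hornerMatrix M s)ᵀ * hornerMatrix M s') := sum_congr rfl fun s _ => sum_comm
    _ = ∑ a, ∑ s ∈ range k, ∑ s' ∈ range k, (μ a ^ (s + s') * (lagrangeProj M μ a).trace) •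
          ((hornerMatrix M s)ᵀ * hornerMatrix M s') := sum_comm

end Field

/-! ### Positive definiteness over `ℝ` -/

section Real

variable {n ι : Type*} [Fintype n] [DecidableEq n] [Fintype ι] [DecidableEq ι]
  {M : Matrix n n ℝ} {μ : ι → ℝ}

/-- The trace of a nonzero idempotent real matrix is positive (it is the rank). [folklore] -/
theorem trace_pos_of_isIdempotentElem {P : Matrix n n ℝ} (hP : P * P = P) (hP0 : P ≠ 0) :
    0 < P.trace := by
  have hid : IsIdempotentElem (Matrix.toLin' P) := by
    change Matrix.toLin' P * Matrix.toLin' P = Matrix.toLin' P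
    rw [Module.End.mul_eq_comp, ← Matrix.toLin'_mul, hP]
  have htr := (LinearMap.IsIdempotentElem.isProj_range _ hid).trace
  rw [Matrix.trace_toLin'_eq] at htr
  rw [htr, Nat.cast_pos, Module.finrank_pos_iff, Submodule.nontrivial_iff_ne_bot, Ne,
    LinearMap.range_eq_bot]
  intro h0
  exact hP0 ((LinearEquiv.map_eq_zero_iff Matrix.toLin').1 h0)

omit [DecidableEq n] in
/-- `0 ≤ v ⬝ᵥ v` for real vectors. [folklore] -/
theorem dotProduct_self_nonneg_real (v : n → ℝ) : 0 ≤ v ⬝ᵥ v :=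
  Finset.sum_nonneg fun i _ => mul_self_nonneg (v i)

/-- **The quadratic form of `H(M)`**: `xᵀ H x = Σₐ tr(Πₐ) ‖Qₐ x‖²`. [folklore] -/
theorem dotProduct_hornerSymmetrizer_mulVec (hμ : Function.Injective μ)
    (hchar : M.charpoly = ∏ a, (X - C (μ a))) (x : n → ℝ) :
    x ⬝ᵥ (hornerSymmetrizer M *ᵥ x) =
      ∑ a, (lagrangeProj M μ a).trace *
        ((hornerQuotient M (μ a) *ᵥ x) ⬝ᵥ (hornerQuotient M (μ a) *ᵥ x)) := by
  rw [hornerSymmetrizer_eq_sum_lagrange hμ hchar, sum_mulVec, dotProduct_sum]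
  refine sum_congr rfl fun a _ => ?_
  rw [smul_mulVec, dotProduct_smul, smul_eq_mul, ← mulVec_mulVec, dotProduct_mulVec,
    vecMul_transpose]

/-- **Positive definiteness** ([HornJohnson2013, 7.6.P1 (b) ⇒ (d)] in closed form): if
`charpoly M = ∏ₐ (X - μₐ)` with the `μₐ` pairwise distinct (simple real spectrum), then `H(M)`
is symmetric positive definite: each `tr(Πₐ) = rank Πₐ > 0` and `x = Σₐ Πₐx = Σₐ wₐ Qₐx`, so
`xᵀHx = Σₐ tr(Πₐ)‖Qₐx‖² > 0` for `x ≠ 0`. [cite: HornJohnson2013, §7.6 Problem 7.6.P1] -/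
theorem posDef_hornerSymmetrizer (hμ : Function.Injective μ)
    (hchar : M.charpoly = ∏ a, (X - C (μ a))) : (hornerSymmetrizer M).PosDef := by
  refine Matrix.PosDef.of_dotProduct_mulVec_pos ?_ fun x hx => ?_
  · show (hornerSymmetrizer M)ᴴ = hornerSymmetrizer M
    rw [conjTranspose_eq_transpose_of_trivial]
    exact isSymm_hornerSymmetrizer M
  rw [star_trivial, dotProduct_hornerSymmetrizer_mulVec hμ hchar]
  -- some `Qₐ x ≠ 0`, since `x = Σₐ wₐ Qₐ x`
  obtain ⟨a, ha⟩ : ∃ a, hornerQuotient M (μ a) *ᵥ x ≠ 0 := by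
    by_contra! h
    apply hx
    have hx' : x = ∑ a, lagrangeProj M μ a *ᵥ x := by
      rw [← sum_mulVec, sum_lagrangeProj hμ hchar, one_mulVec]
    rw [hx']
    exact sum_eq_zero fun a _ => by
      rw [lagrangeProj_eq_smul_hornerQuotient hchar, smul_mulVec, h a, smul_zero]
  have hpos : ∀ b, 0 < (lagrangeProj M μ b).trace := fun b =>
    trace_pos_of_isIdempotentElem (lagrangeProj_mul_self hμ hchar b) (lagrangeProj_ne_zero hμ hchar b)
  refine sum_pos' (fun b _ => mul_nonneg (hpos b).le (dotProduct_self_nonneg_real _))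
    ⟨a, mem_univ a, mul_pos (hpos a) ?_⟩
  exact lt_of_le_of_ne (dotProduct_self_nonneg_real _)
    (Ne.symm fun h0 => ha (dotProduct_self_eq_zero.1 h0))

/-- **Symmetrizability of matrices with simple real spectrum** (existence form): there is a
symmetric positive definite `H` with `HM` symmetric, i.e. `HM = MᵀH`.
[cite: HornJohnson2013, §7.6 Problem 7.6.P1 and Cor. 7.6.2] -/
theorem exists_posDef_symmetrizer (hμ : Function.Injective μ)
    (hchar : M.charpoly = ∏ a, (X - C (μ a))) :
    ∃ H : Matrix n n ℝ, H.PosDef ∧ (H * M).IsSymm ∧ H * M = Mᵀ * H :=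
  ⟨hornerSymmetrizer M, posDef_hornerSymmetrizer hμ hchar, isSymm_hornerSymmetrizer_mul M,
    hornerSymmetrizer_mul_eq_transpose_mul M⟩

end Real

end Literature.LinearAlgebra.Matrix

end
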